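import Mathlib
import Literature.Analysis.FluidPDE.VectorCalculus
import Summits.NavierStokesRegularity.NavierStokesRegularity.Theorems.UnthreadedDoorFluxStarvedDipoleLatitudeModes
import Summits.NavierStokesRegularity.NavierStokesRegularity.Theorems.UnthreadedDoorNetFluxOscLeVorticity
import HarnessLib

/-!
# Route `UnthreadedDoor`, crux `PoloidalLiouville` (stmt-NavierStokesRegularity-1222), wall W1 — crux idea
# «flux-starved-dipoles»: L0 `SphereTangentUnthreadedVanishes` — SPHERE-TANGENT UNTHREADED SOLENOIDAL FIELDS VANISH

The sketch Prop `FluxStarvedDipole.SphereTangentUnthreadedVanishes` (classical Mie/Backus: a `C¹` divergence-free field tangent to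
the spheres of a shell about `x₀` and unthreaded there vanishes on the shell) VERBATIM, proved WITHOUT Hodge theory on `S²`:
on every latitude circle of every axis, all Fourier modes of the tangential components vanish (`latitudeModes_eq_zero` for
`k ≥ 1`; `latitudeCirculation_eq_zero_of_unthreaded`, `latitudeFlux_eq_zero_of_tangent_divFree` for `k = 0`), so by Fourier
uniqueness on the circle (`eq_zero_of_latitudeModes_zero`, from Mathlib's `has_pointwise_sum_fourier_series_of_summable`) the
tangential components vanish; through any point `x` of the shell passes the equator of an axis `n ⊥ x − x₀`.

* `eq_zero_of_latitudeModes_zero` — a continuous `2π`-periodic real function all of whose `cos kφ` / `sin kφ` moments vanish is zero;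
* `sphereTangentUnthreadedVanishes` — the sketch Prop L0, unfolded.

With `fluxStarvation(Steady)` (p838510/p838637) and the sketch glue `nonSolidDipolarShellAtRest(On)_of`, the card's
`NonSolidDipolarShellAtRest(On)` become unconditional (the glue lives in the Cruxes sketch; both inputs are now theorems).
HONEST LABEL: kinematics of the unthreaded class (information-grade for W1, movement 0); C2 `DipolarWindowIrrotational` still needs its
component argument, K1′ its parabolic endgame; `PoloidalLiouville` (1222), its wall `stub_scalarLiouville` and the summit stay OPEN;
NO Navier–Stokes regularity statement is proved.  `--supports stmt-NavierStokesRegularity-1222` (helper).  [folklore]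
-/

noncomputable section

-- the summit and its single sub-problem share the name (CONVENTIONS §1)
set_option linter.dupNamespace false

open Set Filter Topology InnerProductSpace MeasureTheory
open scoped RealInnerProductSpace
open Literature.Analysis.FluidPDE
open Summit.NavierStokesRegularity.NavierStokesRegularity.Theorems.PoloidalLiouville.HorizonTower (E3)
open Summit.NavierStokesRegularity.NavierStokesRegularity.Theorems.PoloidalLiouville.HorizonTower.Zonal (frameBasis
  frameBasis_apply frameVec_zero frameVec_one frameVec_two)

namespace Summit.NavierStokesRegularity.NavierStokesRegularity.Theorems.PoloidalLiouville.FluxStarvedDipole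

/-! ### Fourier uniqueness on the circle -/

/-- **Fourier uniqueness on the circle, real form.**  A continuous `2π`-periodic `g : ℝ → ℝ` with
`∫₀^{2π} cos(kφ) g = ∫₀^{2π} sin(kφ) g = 0` for all `k ∈ ℕ` vanishes identically (all Fourier coefficients of its lift to
`AddCircle (2π)` vanish, so its Fourier series — trivially summable — sums pointwise to it: Mathlib
`has_pointwise_sum_fourier_series_of_summable`). [folklore] -/
theorem eq_zero_of_latitudeModes_zero {g : ℝ → ℝ} (hg : Continuous g) (hper : Function.Periodic g (2 * Real.pi))
    (hcos : ∀ k : ℕ, ∫ φ in (0 : ℝ)..2 * Real.pi, Real.cos (k * φ) * g φ = 0)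
    (hsin : ∀ k : ℕ, ∫ φ in (0 : ℝ)..2 * Real.pi, Real.sin (k * φ) * g φ = 0) (φ₀ : ℝ) : g φ₀ = 0 := by
  haveI : Fact (0 < 2 * Real.pi) := ⟨by positivity⟩
  have hT : (0 : ℝ) < 2 * Real.pi := by positivity
  set G : ℝ → ℂ := fun φ => (g φ : ℂ) with hG
  have hGc : Continuous G := Complex.continuous_ofReal.comp hg
  have hG0 : G 0 = G (0 + 2 * Real.pi) := by simp only [hG, zero_add]; rw [← hper 0, zero_add]
  set f : C(AddCircle (2 * Real.pi), ℂ) :=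
    ⟨AddCircle.liftIco (2 * Real.pi) 0 G, AddCircle.liftIco_continuous hG0 hGc.continuousOn⟩ with hf
  -- `f ↑x = G x` on `[0, 2π]`
  have hfx : ∀ x ∈ Icc (0 : ℝ) (2 * Real.pi), f (x : AddCircle (2 * Real.pi)) = G x := by
    intro x hx
    rcases eq_or_lt_of_le hx.2 with h | h
    · rw [h, AddCircle.coe_period, ← AddCircle.coe_zero]
      show AddCircle.liftIco (2 * Real.pi) 0 G ((0 : ℝ) : AddCircle (2 * Real.pi)) = G (2 * Real.pi)
      rw [AddCircle.liftIco_zero_coe_apply (by simp [hT]), hG0, zero_add]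
    · show AddCircle.liftIco (2 * Real.pi) 0 G (x : AddCircle (2 * Real.pi)) = G x
      exact AddCircle.liftIco_zero_coe_apply ⟨hx.1, h⟩
  -- real moments for integer frequencies
  have hmomR : ∀ n : ℤ, (∫ φ in (0 : ℝ)..2 * Real.pi, Real.cos (n * φ) * g φ) = 0 ∧
      (∫ φ in (0 : ℝ)..2 * Real.pi, Real.sin (n * φ) * g φ) = 0 := by
    intro n
    obtain ⟨k, hk | hk⟩ := Int.eq_nat_or_neg n
    · rw [hk]; push_cast; exact ⟨hcos k, hsin k⟩
    · rw [hk]; push_cast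
      constructor
      · have : (fun φ => Real.cos (-(k : ℝ) * φ) * g φ) = fun φ => Real.cos (k * φ) * g φ := by
          funext φ; rw [neg_mul, Real.cos_neg]
        rw [this]; exact hcos k
      · have : (fun φ => Real.sin (-(k : ℝ) * φ) * g φ) = fun φ => -(Real.sin (k * φ) * g φ) := by
          funext φ; rw [neg_mul, Real.sin_neg, neg_mul]
        rw [this, intervalIntegral.integral_neg, hsin k, neg_zero]
  -- all Fourier coefficients vanish
  have hcoef : ∀ n : ℤ, fourierCoeff (⇑f) n = 0 := by
    intro n
    rw [fourierCoeff_eq_intervalIntegral (⇑f) n 0, zero_add]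
    have hπ : (Real.pi : ℂ) ≠ 0 := by exact_mod_cast Real.pi_ne_zero
    have hpt : ∀ x ∈ uIcc (0 : ℝ) (2 * Real.pi),
        (fourier (-n) (x : AddCircle (2 * Real.pi))) • f (x : AddCircle (2 * Real.pi))
          = ((Real.cos (n * x) * g x : ℝ) : ℂ) - Complex.I * ((Real.sin (n * x) * g x : ℝ) : ℂ) := by
      intro x hx
      rw [uIcc_of_le hT.le] at hx
      rw [hfx x hx, fourier_coe_apply, smul_eq_mul]
      have harg : 2 * (Real.pi : ℂ) * Complex.I * ((-n : ℤ) : ℂ) * (x : ℂ) / ((2 * Real.pi : ℝ) : ℂ)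
          = (-((n : ℂ) * (x : ℂ))) * Complex.I := by
        push_cast
        field_simp
      rw [harg, Complex.exp_mul_I, Complex.cos_neg, Complex.sin_neg]
      simp only [hG]
      push_cast
      ring
    rw [intervalIntegral.integral_congr hpt, intervalIntegral.integral_sub, intervalIntegral.integral_const_mul,
      intervalIntegral.integral_ofReal, intervalIntegral.integral_ofReal, (hmomR n).1, (hmomR n).2]
    · simp
    · exact (Complex.continuous_ofReal.comp ((Real.continuous_cos.comp (continuous_const.mul continuous_id)).mul
        hg)).intervalIntegrable _ _
    · exact (continuous_const.mul (Complex.continuous_ofReal.comp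
        ((Real.continuous_sin.comp (continuous_const.mul continuous_id)).mul hg))).intervalIntegrable _ _
  -- hence `f = 0` pointwise
  have hzero : fourierCoeff (⇑f) = 0 := funext hcoef
  have hfz : ∀ x : AddCircle (2 * Real.pi), f x = 0 := by
    intro x
    have h := has_pointwise_sum_fourier_series_of_summable (f := f) (by rw [hzero]; exact summable_zero) x
    rw [hzero] at h
    simp only [Pi.zero_apply, zero_smul] at h
    exact h.unique hasSum_zero
  -- reduce `φ₀` into `[0, 2π)`
  have hmem := toIcoMod_mem_Ico hT 0 φ₀
  rw [zero_add] at hmem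
  have hred : g φ₀ = g (toIcoMod hT 0 φ₀) := by
    rw [← self_sub_toIcoDiv_zsmul hT 0 φ₀, hper.sub_zsmul_eq]
  have h := hfx (toIcoMod hT 0 φ₀) ⟨hmem.1, hmem.2.le⟩
  rw [hfz] at h
  rw [hred]
  have h' : G (toIcoMod hT 0 φ₀) = 0 := h.symm
  simp only [hG] at h'
  exact_mod_cast h'

/-! ### L0 -/

/-- **L0 — SPHERE-TANGENT UNTHREADED SOLENOIDAL FIELDS VANISH** — the sketch Prop `FluxStarvedDipole.SphereTangentUnthreadedVanishes`
VERBATIM: if `u ∈ C¹(ℝ³)` is divergence-free, tangent to the spheres `S_r(x₀)`, `r₁ < r < r₂` (`0 ≤ r₁`), and unthreaded about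
`x₀` there (`⟪x − x₀, curl u(x)⟫ = 0`), then `u ≡ 0` on that shell.  Proof: given `x` on the shell, pick a unit axis `n ⊥ x − x₀`
and `e = (x − x₀)/‖x − x₀‖`; `x` lies on the equator (`θ = π/2`, `φ = 0`) of the frame `(n, e, n × e)`; all latitude Fourier modes
of `u_θ`, `u_φ` on this equator vanish (`latitudeModes_eq_zero`, `latitudeCirculation_eq_zero_of_unthreaded`,
`latitudeFlux_eq_zero_of_tangent_divFree`), so `u_θ(x) = u_φ(x) = 0` by `eq_zero_of_latitudeModes_zero`, and `u_ξ(x) = 0` by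
tangency; expand `u(x)` in the orthonormal frame. [folklore] -/
theorem sphereTangentUnthreadedVanishes :
    ∀ (u : E3 → E3) (x₀ : E3) (r₁ r₂ : ℝ), 0 ≤ r₁ → r₁ < r₂ →
      ContDiff ℝ 1 u → Literature.Analysis.FluidPDE.VectorCalculus.IsDivFree u →
      (∀ x, r₁ < ‖x - x₀‖ → ‖x - x₀‖ < r₂ → ⟪u x, x - x₀⟫ = 0) →
      (∀ x, r₁ < ‖x - x₀‖ → ‖x - x₀‖ < r₂ → ⟪x - x₀, curl u x⟫ = 0) →
      ∀ x, r₁ < ‖x - x₀‖ → ‖x - x₀‖ < r₂ → u x = 0 := by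
  intro u x₀ r₁ r₂ hr₁ _ hu hdiv htan hunthr x hx₁ hx₂
  -- the radius, an axis `n ⊥ x − x₀`, and `e = (x − x₀)/ρ`
  obtain ⟨ρ, hρ⟩ : ∃ ρ : ℝ, ρ = ‖x - x₀‖ := ⟨_, rfl⟩
  have hρpos : 0 < ρ := by rw [hρ]; exact lt_of_le_of_lt hr₁ hx₁
  have h₁ : r₁ < ρ := by rw [hρ]; exact hx₁
  have h₂ : ρ < r₂ := by rw [hρ]; exact hx₂
  obtain ⟨n, hn, hny⟩ := NetFlux.exists_unit_orth (x - x₀)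
  obtain ⟨e, he_def⟩ : ∃ e : E3, e = ρ⁻¹ • (x - x₀) := ⟨_, rfl⟩
  have he : ‖e‖ = 1 := by rw [he_def, norm_smul, norm_inv, Real.norm_of_nonneg hρpos.le, ← hρ, inv_mul_cancel₀ hρpos.ne']
  have hne : ⟪n, e⟫ = 0 := by rw [he_def, inner_smul_right, hny, mul_zero]
  have hxe : x - x₀ = ρ • e := by rw [he_def, smul_smul, mul_inv_cancel₀ hρpos.ne', one_smul]
  -- unthreadedness on the sphere `S_ρ(x₀)`
  have hunthr' : ∀ y : E3, ‖y‖ = ρ → ⟪y, curl u (x₀ + y)⟫ = 0 := by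
    intro y hy
    have h := hunthr (x₀ + y) (by rw [add_sub_cancel_left, hy]; exact h₁) (by rw [add_sub_cancel_left, hy]; exact h₂)
    rwa [add_sub_cancel_left] at h
  -- `x` is the point `θ = π/2`, `φ = 0` of the latitude family of the frame `(n, e, n × e)`
  have hpt : x₀ + (ρ * Real.cos (Real.pi / 2)) • n + (ρ * Real.sin (Real.pi / 2)) •
      (Real.cos 0 • e + Real.sin 0 • cross n e) = x := by
    rw [Real.cos_pi_div_two, Real.sin_pi_div_two, Real.cos_zero, Real.sin_zero, mul_zero, zero_smul, add_zero, mul_one,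
      one_smul, zero_smul, add_zero, ← hxe, add_sub_cancel]
  have hθ : Real.pi / 2 ∈ Ioo 0 Real.pi := ⟨by positivity, by linarith [Real.pi_pos]⟩
  -- the two tangential components along the equator, as continuous periodic functions of `φ`
  have huc : Continuous u := hu.continuous
  have hgφc : Continuous fun φ : ℝ => ⟪u (x₀ + (ρ * Real.cos (Real.pi / 2)) • n + (ρ * Real.sin (Real.pi / 2)) • (Real.cos φ • e + Real.sin φ • cross n e)), ((-Real.sin φ) • e + Real.cos φ • cross n e)⟫ := by fun_prop
  have hgθc : Continuous fun φ : ℝ => ⟪u (x₀ + (ρ * Real.cos (Real.pi / 2)) • n + (ρ * Real.sin (Real.pi / 2)) • (Real.cos φ • e + Real.sin φ • cross n e)), ((-Real.sin (Real.pi / 2)) • n + Real.cos (Real.pi / 2) • (Real.cos φ • e + Real.sin φ • cross n e))⟫ := by fun_prop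
  have hgφp : Function.Periodic (fun φ : ℝ => ⟪u (x₀ + (ρ * Real.cos (Real.pi / 2)) • n + (ρ * Real.sin (Real.pi / 2)) • (Real.cos φ • e + Real.sin φ • cross n e)), ((-Real.sin φ) • e + Real.cos φ • cross n e)⟫) (2 * Real.pi) := by
    intro φ
    simp only [Real.cos_add_two_pi, Real.sin_add_two_pi]
  have hgθp : Function.Periodic (fun φ : ℝ => ⟪u (x₀ + (ρ * Real.cos (Real.pi / 2)) • n + (ρ * Real.sin (Real.pi / 2)) • (Real.cos φ • e + Real.sin φ • cross n e)), ((-Real.sin (Real.pi / 2)) • n + Real.cos (Real.pi / 2) • (Real.cos φ • e + Real.sin φ • cross n e))⟫) (2 * Real.pi) := by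
    intro φ
    simp only [Real.cos_add_two_pi, Real.sin_add_two_pi]
  -- all modes vanish
  have hmodes : ∀ k : ℕ,
      (∫ φ in (0 : ℝ)..2 * Real.pi, Real.cos (k * φ) * ⟪u (x₀ + (ρ * Real.cos (Real.pi / 2)) • n + (ρ * Real.sin (Real.pi / 2)) • (Real.cos φ • e + Real.sin φ • cross n e)), ((-Real.sin φ) • e + Real.cos φ • cross n e)⟫) = 0 ∧
      (∫ φ in (0 : ℝ)..2 * Real.pi, Real.sin (k * φ) * ⟪u (x₀ + (ρ * Real.cos (Real.pi / 2)) • n + (ρ * Real.sin (Real.pi / 2)) • (Real.cos φ • e + Real.sin φ • cross n e)), ((-Real.sin φ) • e + Real.cos φ • cross n e)⟫) = 0 ∧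
      (∫ φ in (0 : ℝ)..2 * Real.pi, Real.cos (k * φ) * ⟪u (x₀ + (ρ * Real.cos (Real.pi / 2)) • n + (ρ * Real.sin (Real.pi / 2)) • (Real.cos φ • e + Real.sin φ • cross n e)), ((-Real.sin (Real.pi / 2)) • n + Real.cos (Real.pi / 2) • (Real.cos φ • e + Real.sin φ • cross n e))⟫) = 0 ∧
      (∫ φ in (0 : ℝ)..2 * Real.pi, Real.sin (k * φ) * ⟪u (x₀ + (ρ * Real.cos (Real.pi / 2)) • n + (ρ * Real.sin (Real.pi / 2)) • (Real.cos φ • e + Real.sin φ • cross n e)), ((-Real.sin (Real.pi / 2)) • n + Real.cos (Real.pi / 2) • (Real.cos φ • e + Real.sin φ • cross n e))⟫) = 0 := by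
    intro k
    rcases Nat.eq_zero_or_pos k with hk | hk
    · subst hk
      have hC := latitudeCirculation_eq_zero_of_unthreaded hu x₀ hρpos hunthr' hn he hne (Real.pi / 2)
      have hF := latitudeFlux_eq_zero_of_tangent_divFree hu hdiv x₀ hr₁ h₁ h₂ htan hn he hne (Real.pi / 2)
      have hs1 : Real.sin (Real.pi / 2) ≠ 0 := by rw [Real.sin_pi_div_two]; exact one_ne_zero
      rw [intervalIntegral.integral_const_mul] at hC hF
      have hC' := (mul_eq_zero.mp hC).resolve_left hs1
      have hF' := (mul_eq_zero.mp hF).resolve_left hs1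
      simp only [Nat.cast_zero, zero_mul, Real.cos_zero, Real.sin_zero, one_mul, intervalIntegral.integral_zero]
      exact ⟨hC', trivial, hF', trivial⟩
    · exact latitudeModes_eq_zero hu hdiv x₀ hr₁ h₁ h₂ htan hunthr' hn he hne (Nat.pos_iff_ne_zero.mp hk) hθ
  have hφ0 := eq_zero_of_latitudeModes_zero hgφc hgφp (fun k => (hmodes k).1) (fun k => (hmodes k).2.1) 0
  have hθ0 := eq_zero_of_latitudeModes_zero hgθc hgθp (fun k => (hmodes k).2.2.1) (fun k => (hmodes k).2.2.2) 0
  rw [hpt] at hφ0 hθ0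
  rw [Real.sin_zero, Real.cos_zero, neg_zero, zero_smul, zero_add, one_smul] at hφ0
  rw [Real.sin_pi_div_two, Real.cos_pi_div_two, zero_smul, add_zero, inner_smul_right, neg_one_mul, neg_eq_zero] at hθ0
  -- tangency: the `e`-component vanishes
  have he0 : ⟪u x, e⟫ = 0 := by
    have h := htan x hx₁ hx₂
    rw [hxe, inner_smul_right] at h
    rcases mul_eq_zero.mp h with h' | h'
    · exact absurd h' hρpos.ne'
    · exact h'
  -- expand in the orthonormal frame `(n, e, n × e)`
  have hexp := (frameBasis hn he hne).sum_repr' (u x)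
  rw [Fin.sum_univ_three, frameBasis_apply, frameBasis_apply, frameBasis_apply, frameVec_zero, frameVec_one, frameVec_two,
    real_inner_comm (u x) n, hθ0, real_inner_comm (u x) e, he0, real_inner_comm (u x) (cross n e), hφ0, zero_smul,
    zero_smul, zero_smul, add_zero, add_zero] at hexp
  exact hexp.symm

end Summit.NavierStokesRegularity.NavierStokesRegularity.Theorems.PoloidalLiouville.FluxStarvedDipole

end
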